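import Mathlib
import HarnessLib
import Summits.Ventures.LatticeQCDFlow.Exactness.SphereLuscherConstantsTorusTriangleFree
import Summits.Ventures.LatticeQCDFlow.Exactness.SphereLOFlowLightCone

/-!
# Cone geometry of the nearest-neighbour torus `(ℤ/L)^ν`: the radius-`r` balls of the coupling neighbourhoods lie in sup-boxes of side `2r+1`, cone neighbourhoods of a block have at most `|B|·(2m+3)^ν` sites, box-apart blocks are separated, and coupled pairs have no common neighbour (`L ≠ 3`)

HONEST FRAMING: exact (Metropolis-corrected) sampling algorithms for lattice gauge theory;
figures of merit are autocorrelation/cost numbers at stated couplings and volumes; no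
continuum-physics claim.

Venture `LatticeQCDFlow` (cell pub-lqcd), topic `Exactness`; FANOUT row 7 (`s0-cpn-null`: the
S0-D1 rung — 2D CP⁹ on periodic `L × L` lattices).  NEW WORK of the cell over the tree's
`Exactness/SphereLuscherConstantsTorusTriangleFree.lean` (the nearest-neighbour torus graph with
`L ≠ 3` is triangle-free), `Exactness/SphereLuscherSeriesLocality.lean` /
`Exactness/SphereLuscherSeriesLocalityES.lean` (the balls `nball N r n` of a neighbourhood structure,
`couplingNbhd U n = {m | U n m ≠ 0}`) and the Literature torus `Site ν L = (ℤ/L)^ν`, `Site.shift`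
(`Literature/MathematicalPhysics/QuantumFieldTheory/ConstructiveQFTWave0`); nothing is cited as a fact.
Printed counterpart, NAMED ONLY: Engel–Schaefer, Comput. Phys. Commun. 182 (2011) 2107, §2 (the
periodic square lattice of the CP(N−1) simulations).  These are the COMBINATORIAL INPUTS that the
explicit extensive entropy floor of this lineage (`Exactness/SphereLOFlowEntropyFloorExplicit`,
`…SmallTime`) asks of a concrete lattice: a bound `I₀` on the cone neighbourhood of a block that does
not see the volume, a checkable separation criterion for blocks, and the no-common-neighbour property
of coupled pairs.

## Setting

`Site ν L = Fin ν → ZMod L` (`L ≥ 1`); a coupling family `U : Site ν L → Site ν L → β` (`β` with a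
zero) supported on nearest neighbours (`U x y ≠ 0 → ∃ i, y = x.shift i ∨ x = y.shift i`);
`N n = {n} ∪ couplingNbhd U n`; the SUP-BOX of radius `r` about `x`,
`Box r x = {x + v mod L : v ∈ ℤ^ν, |v_i| ≤ r}`, written as the image of `[-r, r]^ν` (a `Finset`).

## Content

* §1 `torus_mem_box_iff`, `torus_mem_box_self`, `torus_box_mono`, `torus_mem_box_comm`, `torus_mem_box_add` (boxes compose:
  radius `r + r'`), `torus_add_single_mem_box_succ` (a unit step leaves `Box r` inside `Box (r+1)`).
* §2 **`torus_nball_subset_box`** — `nball N r x ⊆ Box r x` for nearest-neighbour couplings;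
  **`torus_card_box_le`** — `|Box r x| ≤ (2r+1)^ν`; **`card_coneNbhd_le`** —
  `|{n : nball N (m+1) n ∩ B ≠ ∅}| ≤ |B|·(2(m+1)+1)^ν` (VOLUME-INDEPENDENT);
  **`blocks_separated_of_box_apart`** — blocks pairwise `Box (2(m+1))`-apart are separated for the
  radius-`(m+1)` balls.
* §3 **`torus_pair_no_common_neighbour`** — on `(ℤ/L)^ν`, `L ≠ 3`, with symmetric nearest-neighbour
  support and no self-coupling, a coupled pair `U k l ≠ 0` has no common neighbour:
  `U n k = 0 ∨ U n l = 0` for every `n`.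

NOT CLAIMED: a particular block family (sublattice tilings) or its count; anything about measures,
flows or numbers.
-/

noncomputable section

namespace Summit.Ventures.LatticeQCDFlow.Exactness

open Function Set Literature.MathematicalPhysics.QuantumFieldTheory
open scoped Classical

variable {ν L : ℕ}

/-! ## §1 Sup-boxes on the torus -/

section Box

/-- Membership in the sup-box: `y ∈ Box r x ↔ y = x + v (mod L)` for some `v ∈ ℤ^ν` with `|v_i| ≤ r`. -/
theorem torus_mem_box_iff {r : ℕ} {x y : Site ν L} :
    y ∈ (Fintype.piFinset fun _ : Fin ν => Finset.Icc (-(r : ℤ)) (r : ℤ)).image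
        (fun v : Fin ν → ℤ => x + fun i => ((v i : ℤ) : ZMod L)) ↔
      ∃ v : Fin ν → ℤ, (∀ i, |v i| ≤ r) ∧ y = x + fun i => ((v i : ℤ) : ZMod L) := by
  simp only [Finset.mem_image, Fintype.mem_piFinset, Finset.mem_Icc, ← abs_le]
  constructor
  · rintro ⟨v, hv, h⟩; exact ⟨v, hv, h.symm⟩
  · rintro ⟨v, hv, h⟩; exact ⟨v, hv, h.symm⟩

/-- `x ∈ Box r x`. -/
theorem torus_mem_box_self (r : ℕ) (x : Site ν L) :
    x ∈ (Fintype.piFinset fun _ : Fin ν => Finset.Icc (-(r : ℤ)) (r : ℤ)).image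
        (fun v : Fin ν → ℤ => x + fun i => ((v i : ℤ) : ZMod L)) :=
  torus_mem_box_iff.2 ⟨0, fun i => by simp, by ext i; simp⟩

/-- Boxes grow with the radius. -/
theorem torus_box_mono {r r' : ℕ} (h : r ≤ r') (x : Site ν L) :
    (Fintype.piFinset fun _ : Fin ν => Finset.Icc (-(r : ℤ)) (r : ℤ)).image
        (fun v : Fin ν → ℤ => x + fun i => ((v i : ℤ) : ZMod L)) ⊆
      (Fintype.piFinset fun _ : Fin ν => Finset.Icc (-(r' : ℤ)) (r' : ℤ)).image
        (fun v : Fin ν → ℤ => x + fun i => ((v i : ℤ) : ZMod L)) := by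
  intro y hy
  obtain ⟨v, hv, rfl⟩ := torus_mem_box_iff.1 hy
  exact torus_mem_box_iff.2 ⟨v, fun i => (hv i).trans (by exact_mod_cast h), rfl⟩

/-- Boxes are symmetric: `y ∈ Box r x ↔ x ∈ Box r y`. -/
theorem torus_mem_box_comm {r : ℕ} {x y : Site ν L} :
    y ∈ (Fintype.piFinset fun _ : Fin ν => Finset.Icc (-(r : ℤ)) (r : ℤ)).image
        (fun v : Fin ν → ℤ => x + fun i => ((v i : ℤ) : ZMod L)) ↔
      x ∈ (Fintype.piFinset fun _ : Fin ν => Finset.Icc (-(r : ℤ)) (r : ℤ)).image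
        (fun v : Fin ν → ℤ => y + fun i => ((v i : ℤ) : ZMod L)) := by
  constructor
  · intro h
    obtain ⟨v, hv, rfl⟩ := torus_mem_box_iff.1 h
    refine torus_mem_box_iff.2 ⟨-v, fun i => by rw [Pi.neg_apply, abs_neg]; exact hv i, ?_⟩
    ext i; simp
  · intro h
    obtain ⟨v, hv, rfl⟩ := torus_mem_box_iff.1 h
    refine torus_mem_box_iff.2 ⟨-v, fun i => by rw [Pi.neg_apply, abs_neg]; exact hv i, ?_⟩
    ext i; simp

/-- Boxes compose: `y ∈ Box r x`, `z ∈ Box r' y` ⇒ `z ∈ Box (r + r') x`. -/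
theorem torus_mem_box_add {r r' : ℕ} {x y z : Site ν L}
    (hy : y ∈ (Fintype.piFinset fun _ : Fin ν => Finset.Icc (-(r : ℤ)) (r : ℤ)).image
        (fun v : Fin ν → ℤ => x + fun i => ((v i : ℤ) : ZMod L)))
    (hz : z ∈ (Fintype.piFinset fun _ : Fin ν => Finset.Icc (-(r' : ℤ)) (r' : ℤ)).image
        (fun v : Fin ν → ℤ => y + fun i => ((v i : ℤ) : ZMod L))) :
    z ∈ (Fintype.piFinset fun _ : Fin ν => Finset.Icc (-((r + r' : ℕ) : ℤ)) ((r + r' : ℕ) : ℤ)).image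
        (fun v : Fin ν → ℤ => x + fun i => ((v i : ℤ) : ZMod L)) := by
  obtain ⟨v, hv, rfl⟩ := torus_mem_box_iff.1 hy
  obtain ⟨w, hw, rfl⟩ := torus_mem_box_iff.1 hz
  refine torus_mem_box_iff.2 ⟨v + w, fun i => ?_, ?_⟩
  · rw [Pi.add_apply, Nat.cast_add]
    exact (abs_add_le _ _).trans (add_le_add (hv i) (hw i))
  · ext i; simp [add_assoc]

/-- **A unit step leaves `Box r` inside `Box (r+1)`**: `y ∈ Box r x`, `s = ±1` ⇒
`y + s·e_i ∈ Box (r+1) x`. -/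
theorem torus_add_single_mem_box_succ {r : ℕ} {x y : Site ν L}
    (hy : y ∈ (Fintype.piFinset fun _ : Fin ν => Finset.Icc (-(r : ℤ)) (r : ℤ)).image
        (fun v : Fin ν → ℤ => x + fun i => ((v i : ℤ) : ZMod L)))
    (i : Fin ν) {s : ℤ} (hs : s = 1 ∨ s = -1) :
    y + Pi.single i (s : ZMod L) ∈
      (Fintype.piFinset fun _ : Fin ν => Finset.Icc (-((r + 1 : ℕ) : ℤ)) ((r + 1 : ℕ) : ℤ)).image
        (fun v : Fin ν → ℤ => x + fun i => ((v i : ℤ) : ZMod L)) := by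
  obtain ⟨v, hv, rfl⟩ := torus_mem_box_iff.1 hy
  have hs1 : |s| ≤ 1 := by rcases hs with rfl | rfl <;> simp
  refine torus_mem_box_iff.2 ⟨v + Pi.single i s, fun j => ?_, ?_⟩
  · rw [Pi.add_apply, Nat.cast_add, Nat.cast_one]
    refine (abs_add_le _ _).trans (add_le_add (hv j) ?_)
    by_cases hji : j = i
    · subst hji; rwa [Pi.single_eq_same]
    · rw [Pi.single_eq_of_ne hji, abs_zero]; exact zero_le_one
  · ext j
    simp only [Pi.add_apply]
    by_cases hji : j = i
    · subst hji; simp [add_assoc]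
    · simp [Pi.single_eq_of_ne hji]

end Box

/-! ## §2 Balls of the coupling neighbourhoods, cone neighbourhoods of blocks, separation -/

section Cone

variable {E : Type*} [NormedAddCommGroup E] [InnerProductSpace ℝ E]
  {U : Site ν L → Site ν L → (E →L[ℝ] E)}

/-- **`nball N r x ⊆ Box r x`** for a coupling family supported on nearest neighbours
(`N n = {n} ∪ couplingNbhd U n`). -/
theorem torus_nball_subset_box (hNN : ∀ x y, U x y ≠ 0 → ∃ i : Fin ν, y = x.shift i ∨ x = y.shift i)
    (x : Site ν L) :
    ∀ r : ℕ, nball (fun n => insert n (couplingNbhd U n)) r x ⊆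
      ↑((Fintype.piFinset fun _ : Fin ν => Finset.Icc (-(r : ℤ)) (r : ℤ)).image
        (fun v : Fin ν → ℤ => x + fun i => ((v i : ℤ) : ZMod L)))
  | 0 => by
      intro y hy
      rw [mem_nball_zero] at hy
      subst hy
      exact torus_mem_box_self 0 y
  | r + 1 => by
      intro y hy
      rw [nball_succ] at hy
      rcases hy with hy | hy
      · exact torus_box_mono (Nat.le_succ r) x (torus_nball_subset_box hNN x r hy)
      · obtain ⟨m, hm, hym⟩ := mem_iUnion₂.1 hy
        have hmb := torus_nball_subset_box hNN x r hm
        rcases (Set.mem_insert_iff).1 hym with rfl | hym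
        · exact torus_box_mono (Nat.le_succ r) x hmb
        · obtain ⟨i, h | h⟩ := hNN m y hym
          · rw [h, Site.shift]
            have := torus_add_single_mem_box_succ hmb i (s := 1) (Or.inl rfl)
            rw [Int.cast_one] at this
            exact Finset.mem_coe.2 this
          · have e : y = m + Pi.single i ((-1 : ℤ) : ZMod L) := by
              rw [h, Site.shift, add_assoc, ← Pi.single_add]; simp
            rw [e]
            exact Finset.mem_coe.2 (torus_add_single_mem_box_succ hmb i (Or.inr rfl))

omit [NormedAddCommGroup E] [InnerProductSpace ℝ E] in
/-- **`|Box r x| ≤ (2r+1)^ν`.** -/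
theorem torus_card_box_le (r : ℕ) (x : Site ν L) :
    ((Fintype.piFinset fun _ : Fin ν => Finset.Icc (-(r : ℤ)) (r : ℤ)).image
        (fun v : Fin ν → ℤ => x + fun i => ((v i : ℤ) : ZMod L))).card ≤ (2 * r + 1) ^ ν := by
  refine Finset.card_image_le.trans ?_
  rw [Fintype.card_piFinset, Finset.prod_const, Finset.card_univ, Fintype.card_fin, Int.card_Icc]
  have e : ((r : ℤ) + 1 - -(r : ℤ)).toNat = 2 * r + 1 := by omega
  rw [e]

/-- **THE CONE NEIGHBOURHOOD OF A BLOCK HAS AT MOST `|B|·(2(m+1)+1)^ν` SITES** (nearest-neighbour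
couplings): the set `{n : nball N (m+1) n ∩ B ≠ ∅}` of the entropy floor, bounded independently of the
volume. -/
theorem card_coneNbhd_le [NeZero L] (hNN : ∀ x y, U x y ≠ 0 → ∃ i : Fin ν, y = x.shift i ∨ x = y.shift i)
    (m : ℕ) (B : Finset (Site ν L)) :
    (Finset.univ.filter (fun n : Site ν L =>
        ¬ Disjoint (nball (fun k => insert k (couplingNbhd U k)) (m + 1) n) (↑B : Set (Site ν L)))).card ≤
      B.card * (2 * (m + 1) + 1) ^ ν := by
  have hsub : Finset.univ.filter (fun n : Site ν L =>
      ¬ Disjoint (nball (fun k => insert k (couplingNbhd U k)) (m + 1) n) (↑B : Set (Site ν L))) ⊆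
      B.biUnion fun b => (Fintype.piFinset fun _ : Fin ν => Finset.Icc (-((m + 1 : ℕ) : ℤ)) ((m + 1 : ℕ) : ℤ)).image
        (fun v : Fin ν → ℤ => b + fun i => ((v i : ℤ) : ZMod L)) := by
    intro n hn
    rw [Finset.mem_filter] at hn
    obtain ⟨y, hyn, hyB⟩ := Set.not_disjoint_iff.1 hn.2
    rw [Finset.mem_biUnion]
    exact ⟨y, hyB, torus_mem_box_comm.1 (torus_nball_subset_box hNN n (m + 1) hyn)⟩
  refine (Finset.card_le_card hsub).trans (Finset.card_biUnion_le.trans ?_)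
  refine (Finset.sum_le_card_nsmul _ _ _ fun b _ => torus_card_box_le (m + 1) b).trans ?_
  rw [smul_eq_mul]

/-- **BOX-APART BLOCKS ARE SEPARATED.**  If no site of `B_{j'}` lies in the radius-`2(m+1)` box of a
site of `B_j` (`j ≠ j'`), then no radius-`(m+1)` ball `nball N (m+1) n` meets both blocks. -/
theorem blocks_separated_of_box_apart
    (hNN : ∀ x y, U x y ≠ 0 → ∃ i : Fin ν, y = x.shift i ∨ x = y.shift i) (m : ℕ)
    {J : Type*} (Tb : Finset J) (B : J → Finset (Site ν L))
    (hapart : ∀ j ∈ Tb, ∀ j' ∈ Tb, j ≠ j' → ∀ b ∈ B j, ∀ b' ∈ B j',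
      b' ∉ (Fintype.piFinset fun _ : Fin ν =>
          Finset.Icc (-((m + 1 + (m + 1) : ℕ) : ℤ)) ((m + 1 + (m + 1) : ℕ) : ℤ)).image
        (fun v : Fin ν → ℤ => b + fun i => ((v i : ℤ) : ZMod L))) :
    ∀ n, ∀ j ∈ Tb, ∀ j' ∈ Tb,
      ¬ Disjoint (nball (fun k => insert k (couplingNbhd U k)) (m + 1) n) (↑(B j) : Set (Site ν L)) →
      ¬ Disjoint (nball (fun k => insert k (couplingNbhd U k)) (m + 1) n) (↑(B j') : Set (Site ν L)) →
        j = j' := by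
  intro n j hj j' hj' h1 h2
  by_contra hjj
  obtain ⟨b, hbn, hbB⟩ := Set.not_disjoint_iff.1 h1
  obtain ⟨b', hb'n, hb'B⟩ := Set.not_disjoint_iff.1 h2
  have hb : n ∈ (Fintype.piFinset fun _ : Fin ν => Finset.Icc (-((m + 1 : ℕ) : ℤ)) ((m + 1 : ℕ) : ℤ)).image
      (fun v : Fin ν → ℤ => b + fun i => ((v i : ℤ) : ZMod L)) :=
    torus_mem_box_comm.1 (torus_nball_subset_box hNN n (m + 1) hbn)
  have hb' := torus_nball_subset_box hNN n (m + 1) hb'n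
  exact hapart j hj j' hj' hjj b hbB b' hb'B (torus_mem_box_add hb hb')

end Cone

/-! ## §3 Coupled pairs of the torus have no common neighbour -/

section Pairs

/-- **ON `(ℤ/L)^ν`, `L ≠ 3`, A COUPLED PAIR HAS NO COMMON NEIGHBOUR.**  Nearest-neighbour coupling
family with no self-coupling and symmetric support (`U x y ≠ 0 → U y x ≠ 0`, e.g. adjoint pairs); if
`U k l ≠ 0` then for every site `n`: `U n k = 0 ∨ U n l = 0` (else `k, n, l` would be a triangle). -/
theorem torus_pair_no_common_neighbour [NeZero L] (hL3 : L ≠ 3) {β : Type*} [Zero β]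
    (U : Site ν L → Site ν L → β) (hU0 : ∀ x, U x x = 0)
    (hNN : ∀ x y, U x y ≠ 0 → ∃ i : Fin ν, y = x.shift i ∨ x = y.shift i)
    (hsym : ∀ x y, U x y ≠ 0 → U y x ≠ 0) {k l : Site ν L} (hkl : U k l ≠ 0) (n : Site ν L) :
    U n k = 0 ∨ U n l = 0 := by
  by_contra h
  push Not at h
  exact hkl (torus_nn_triangle_free hL3 U hU0 hNN k n l (hsym n k h.1) h.2)

end Pairs

end Summit.Ventures.LatticeQCDFlow.Exactness

end
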